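import Summits.ABC.ABC.Theses.TwistAmplification
import Literature.NumberTheory.LFunctions.RHWave0PNTProofs
import HarnessLib

/-!
# `TwistAmplification.FreyAmplification` (support item stmt-ABC-2778): the Frey–twist window count
# implies the abc conjecture

Route `TwistAmplification` of the summit `ABC`, item `FreyAmplification`:

> if for some `3 < κ < 6 < σ` and every `ε > 0` there is `C` such that for every `X ≥ 1` every finite
> set `S` of window data `(a, b, c, d)` — an abc triple `(a, b, c)` and `d = 1` or a prime coprime to
> `abc`, with `rad(abc) d² ≤ X` and `κ log(rad(abc) d²) ≤ 6 log(c d) ≤ σ log(rad(abc) d²)` — has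
> `|S| ≤ C X^{1 − κ/6 + ε}`, then the abc conjecture (`_root_.ABC`) holds.

## Proof (elementary bookkeeping + the prime number theorem)

Fix `ε₀ > 0` and an abc triple with `c ≥ rad(abc)^{1+ε₀}`; write `ℓ = log c`, `L = log rad(abc)`, so
`L ≤ (1 − 4ν) ℓ` with `ν = ε₀ / (4(1+ε₀))`.  Put `log D = d := (6ℓ − κL)/(2κ − 6)` and `X := rad(abc)·D²`.
For a prime `p ∈ (D/2, D]` not dividing `abc` the quadruple `(a, b, c, p)` is a window datum: the upper
window condition is exactly `p ≤ D`, the lower one follows from `p > D/2` once `ℓ` is large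
(`(2σ−6)(κ−3) log 2 ≤ 3(σ−κ) ℓ`).  Hence, with `S` the set of these quadruples,

* `|S| ≥ π(D) − π(D/2) − ω(abc) ≥ D/(4 log D) − 5ℓ` by the prime number theorem
  (`Literature.NumberTheory.LFunctions.primeCounting_isEquivalent_holds`) and `ω(n) ≤ log₂ n`;
* `|S| ≤ C X^{1−κ/6+ε}` with `ε := ν(κ−3)/3`, and the exponent identity
  `log D − (1 − κ/6) log X = ℓ − L` gives `C X^{1−κ/6+ε} ≤ max(C,1) · D · e^{−2νℓ}`.

Since `λℓ ≤ log D ≤ 3ℓ/(κ−3)`, `λ = (6 − κ(1−4ν))/(2κ−6) > 0`, the two bounds clash for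
`ℓ ≥ ℓ₀(κ, σ, ν, C)`; so `c ≤ e^{ℓ₀}` for every such triple and `ABC` follows with constant `e^{ℓ₀} + 1`
(main result `Summit.ABC.ABC.Theorems.FreyAmplification_proof`; no elliptic curve is used).
-/

noncomputable section

set_option linter.dupNamespace false

open Real Filter Finset Asymptotics
open Literature.NumberTheory.DiophantineGeometry

namespace Summit.ABC.ABC.Theorems.FreyAmplification

/-! ## 1. The counting input: primes in `(D/2, D]` (PNT) -/

/-- **Primes in a dyadic interval** (from the prime number theorem in the tree,
`π(x) ∼ x / log x`): for all large real `D`, `π(D) − π(D/2) ≥ D / (4 log D)`. -/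
theorem exists_dyadic_primeCounting_lower :
    ∃ D₀ : ℝ, ∀ D : ℝ, D₀ ≤ D →
      D / (4 * Real.log D) ≤ (Nat.primeCounting ⌊D⌋₊ : ℝ) - (Nat.primeCounting ⌊D / 2⌋₊ : ℝ) := by
  have hPNT : (fun x : ℝ ↦ (Nat.primeCounting ⌊x⌋₊ : ℝ)) ~[atTop] fun x ↦ x / Real.log x :=
    Literature.NumberTheory.LFunctions.primeCounting_isEquivalent_holds
  have hb := hPNT.isLittleO.bound (show (0 : ℝ) < 1 / 10 by norm_num)
  obtain ⟨y₀, hy₀⟩ := Filter.eventually_atTop.1 hb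
  refine ⟨max (2 * y₀) (2 ^ 10), fun D hD ↦ ?_⟩
  have hD2 : (2 : ℝ) ^ 10 ≤ D := le_trans (le_max_right _ _) hD
  have hDpos : 0 < D := lt_of_lt_of_le (by norm_num) hD2
  have hy₀D : y₀ ≤ D / 2 := by linarith [le_trans (le_max_left _ _) hD]
  have hy₀D' : y₀ ≤ D := by linarith
  have h1 := hy₀ D hy₀D'
  have h2 := hy₀ (D / 2) hy₀D
  have hlog2 : 10 * Real.log 2 ≤ Real.log D := by
    have h := Real.log_le_log (by norm_num) hD2
    rw [Real.log_pow] at h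
    exact_mod_cast h
  have hlog2pos : 0 < Real.log 2 := Real.log_pos (by norm_num)
  have hlogD : 0 < Real.log D := by linarith
  have hlogD2 : Real.log (D / 2) = Real.log D - Real.log 2 := Real.log_div hDpos.ne' (by norm_num)
  have hlogD2pos : 0 < Real.log (D / 2) := by rw [hlogD2]; linarith
  set u : ℝ := D / Real.log D with hu
  have hupos : 0 < u := div_pos hDpos hlogD
  have hu2pos : 0 < D / 2 / Real.log (D / 2) := div_pos (by linarith) hlogD2pos
  simp only [Pi.sub_apply, Real.norm_eq_abs] at h1 h2
  rw [abs_of_pos hupos] at h1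
  rw [abs_of_pos hu2pos] at h2
  obtain ⟨h1a, _⟩ := abs_le.mp h1
  obtain ⟨_, h2b⟩ := abs_le.mp h2
  have h3 : D / 2 / Real.log (D / 2) ≤ (5 / 9) * u := by
    have h91 : (9 / 10) * Real.log D ≤ Real.log (D / 2) := by rw [hlogD2]; linarith
    calc D / 2 / Real.log (D / 2) ≤ D / 2 / ((9 / 10) * Real.log D) :=
          div_le_div_of_nonneg_left (by linarith) (by positivity) h91
      _ = (5 / 9) * u := by rw [hu]; field_simp; ring
  have h4 : D / (4 * Real.log D) = u / 4 := by rw [hu]; field_simp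
  rw [h4]
  linarith

/-! ## 2. The window: primes `p ∈ (D/2, D]`, `p ∤ abc`, give window data `(a, b, c, p)` -/

/-- **Window verification.** Under the counting hypothesis of `FreyAmplification` at `(κ, σ, ε, C)`:
for an abc triple `(a, b, c)` and a real `D ≥ 1` with `(2κ−6) log D ≤ 6 log c − κ log rad` (upper
window) and `6 log c − σ log rad ≤ (2σ−6)(log D − log 2)` (lower window), the primes `p ∈ (D/2, D]`
not dividing `abc` number at most `C (rad · D²)^{1−κ/6+ε}`. -/
theorem card_window_primes_le {κ σ ε C : ℝ} (hκ : 3 < κ) (hσ : 6 < σ)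
    (hC : ∀ X : ℝ, 1 ≤ X → ∀ S : Finset (ℕ × ℕ × ℕ × ℕ), (∀ t ∈ S,
      Literature.NumberTheory.DiophantineGeometry.IsABCTriple t.1 t.2.1 t.2.2.1 ∧
      (t.2.2.2 = 1 ∨ Nat.Prime t.2.2.2) ∧ Nat.Coprime t.2.2.2 (t.1 * t.2.1 * t.2.2.1) ∧
      ((Literature.NumberTheory.DiophantineGeometry.rad t.1 t.2.1 t.2.2.1 : ℕ) : ℝ) *
        (t.2.2.2 : ℝ) ^ 2 ≤ X ∧
      κ * Real.log (((Literature.NumberTheory.DiophantineGeometry.rad t.1 t.2.1 t.2.2.1 : ℕ) : ℝ) *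
        (t.2.2.2 : ℝ) ^ 2) ≤ 6 * Real.log ((t.2.2.1 : ℝ) * (t.2.2.2 : ℝ)) ∧
      6 * Real.log ((t.2.2.1 : ℝ) * (t.2.2.2 : ℝ)) ≤
        σ * Real.log (((Literature.NumberTheory.DiophantineGeometry.rad t.1 t.2.1 t.2.2.1 : ℕ) : ℝ) *
          (t.2.2.2 : ℝ) ^ 2)) → (S.card : ℝ) ≤ C * X ^ (1 - κ / 6 + ε))
    {a b c : ℕ} (habc : IsABCTriple a b c) {D : ℝ} (hD : 1 ≤ D)
    (hup : (2 * κ - 6) * Real.log D ≤ 6 * Real.log c - κ * Real.log (rad a b c))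
    (hlow : 6 * Real.log c - σ * Real.log (rad a b c) ≤ (2 * σ - 6) * (Real.log D - Real.log 2)) :
    ((((Nat.primesLE ⌊D⌋₊ \ Nat.primesLE ⌊D / 2⌋₊) \ (a * b * c).primeFactors).card : ℕ) : ℝ) ≤
      C * (((rad a b c : ℕ) : ℝ) * D ^ 2) ^ (1 - κ / 6 + ε) := by
  obtain ⟨ha, hb, hsum, hcop⟩ := habc
  have hc : 0 < c := by omega
  have habc0 : a * b * c ≠ 0 := (Nat.mul_pos (Nat.mul_pos ha hb) hc).ne'
  have hm0 : (0 : ℝ) < ((rad a b c : ℕ) : ℝ) := by exact_mod_cast Nat.radical_pos _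
  set P := (Nat.primesLE ⌊D⌋₊ \ Nat.primesLE ⌊D / 2⌋₊) \ (a * b * c).primeFactors with hP
  set f : ℕ → ℕ × ℕ × ℕ × ℕ := fun p ↦ (a, b, c, p) with hf
  have hfinj : Function.Injective f := by
    intro p q h
    simpa [hf] using h
  have hcard : (P.image f).card = P.card := Finset.card_image_of_injective _ hfinj
  have hX : 1 ≤ ((rad a b c : ℕ) : ℝ) * D ^ 2 :=
    one_le_mul_of_one_le_of_one_le (by exact_mod_cast Nat.radical_pos _) (one_le_pow₀ hD)
  have key := hC (((rad a b c : ℕ) : ℝ) * D ^ 2) hX (P.image f) ?_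
  · rwa [hcard] at key
  intro t ht
  rw [Finset.mem_image] at ht
  obtain ⟨p, hp, rfl⟩ := ht
  rw [hP, Finset.mem_sdiff, Finset.mem_sdiff, Nat.mem_primesLE, Nat.mem_primesLE] at hp
  obtain ⟨⟨⟨hpD, hpprime⟩, hpD2⟩, hpF⟩ := hp
  have hp0 : (0 : ℝ) < p := by exact_mod_cast hpprime.pos
  have hpD' : (p : ℝ) ≤ D := (Nat.cast_le.2 hpD).trans (Nat.floor_le (by linarith))
  have hpD2' : D / 2 < p := by
    have : ¬ p ≤ ⌊D / 2⌋₊ := fun h ↦ hpD2 ⟨h, hpprime⟩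
    exact Nat.lt_of_floor_lt (not_le.1 this)
  have hndvd : ¬ p ∣ a * b * c := fun h ↦ hpF (Nat.mem_primeFactors.2 ⟨hpprime, h, habc0⟩)
  have hc0 : (0 : ℝ) < c := by exact_mod_cast hc
  have hlp : Real.log p ≤ Real.log D := Real.log_le_log hp0 hpD'
  have hlp2 : Real.log D - Real.log 2 < Real.log p := by
    rw [← Real.log_div (by linarith) (by norm_num)]
    exact Real.log_lt_log (by linarith) hpD2'
  have hlogmp : Real.log (((rad a b c : ℕ) : ℝ) * (p : ℝ) ^ 2) =
      Real.log (rad a b c) + 2 * Real.log p := by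
    rw [Real.log_mul hm0.ne' (by positivity), Real.log_pow]; push_cast; ring
  have hlogcp : Real.log ((c : ℝ) * (p : ℝ)) = Real.log c + Real.log p :=
    Real.log_mul hc0.ne' hp0.ne'
  refine ⟨⟨ha, hb, hsum, hcop⟩, Or.inr hpprime, (Nat.Prime.coprime_iff_not_dvd hpprime).2 hndvd,
    ?_, ?_, ?_⟩
  · show ((rad a b c : ℕ) : ℝ) * (p : ℝ) ^ 2 ≤ ((rad a b c : ℕ) : ℝ) * D ^ 2
    exact mul_le_mul_of_nonneg_left (pow_le_pow_left₀ hp0.le hpD' 2) hm0.le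
  · show κ * Real.log (((rad a b c : ℕ) : ℝ) * (p : ℝ) ^ 2) ≤ 6 * Real.log ((c : ℝ) * (p : ℝ))
    rw [hlogmp, hlogcp]
    have := mul_le_mul_of_nonneg_left hlp (by linarith : (0 : ℝ) ≤ 2 * κ - 6)
    linarith
  · show 6 * Real.log ((c : ℝ) * (p : ℝ)) ≤ σ * Real.log (((rad a b c : ℕ) : ℝ) * (p : ℝ) ^ 2)
    rw [hlogmp, hlogcp]
    have := mul_le_mul_of_nonneg_left hlp2.le (by linarith : (0 : ℝ) ≤ 2 * σ - 6)
    linarith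

/-! ## 3. Two pieces of real arithmetic -/

/-- **The exponent identity.** With `(2κ−6) d = 6ℓ − κL` (so `log X = L + 2d = 3(2ℓ−L)/(κ−3)`) and
`L ≤ (1 − 4ν) ℓ`: `(1 − κ/6 + ν(κ−3)/3) · (L + 2d) ≤ d − 2νℓ`, i.e.
`X^{1−κ/6+ε} ≤ D · e^{−2νℓ}` for `ε = ν(κ−3)/3`. -/
theorem exponent_mul_log_le {κ ν L ℓ d : ℝ} (hκ : 3 < κ) (hν : 0 < ν) (hL : 0 ≤ L)
    (hviol : L ≤ (1 - 4 * ν) * ℓ) (hd : (2 * κ - 6) * d = 6 * ℓ - κ * L) :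
    (L + 2 * d) * (1 - κ / 6 + ν * (κ - 3) / 3) ≤ d - 2 * ν * ℓ := by
  have hκ3 : 0 < κ - 3 := by linarith
  have hT : (κ - 3) * (L + 2 * d) = 3 * (2 * ℓ - L) := by linear_combination hd
  refine le_of_mul_le_mul_left ?_ (show (0 : ℝ) < 6 * (κ - 3) by linarith)
  have lhs : 6 * (κ - 3) * ((L + 2 * d) * (1 - κ / 6 + ν * (κ - 3) / 3)) =
      ((6 - κ) + 2 * ν * (κ - 3)) * (3 * (2 * ℓ - L)) := by
    rw [← hT]; ring
  have rhs : 6 * (κ - 3) * (d - 2 * ν * ℓ) = 3 * (6 * ℓ - κ * L) - 12 * ν * (κ - 3) * ℓ := by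
    linear_combination 3 * hd
  rw [lhs, rhs]
  have p1 : 0 ≤ (κ - 3) * ((1 - 4 * ν) * ℓ - L) := mul_nonneg hκ3.le (by linarith)
  have p2 : 0 ≤ (κ - 3) * (ν * L) := mul_nonneg hκ3.le (mul_nonneg hν.le hL)
  linarith

/-- **The endgame.** The lower bound `D/(4d) − 5ℓ ≤ N`, the upper bound `N ≤ C₁ D / E`
(`E = e^{2νℓ}`), `24 C₁ ℓ ≤ (κ−3) E`, `(κ−3) d ≤ 3ℓ` and `121 ℓ² ≤ (κ−3) D` are incompatible
(`ℓ ≥ 1`, `d, D, E > 0`). -/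
theorem endgame_false {κ ℓ d D E C₁ N : ℝ} (hℓ : 1 ≤ ℓ) (hd : 0 < d) (hD : 0 < D)
    (hE : 0 < E) (hNlow : D / (4 * d) - 5 * ℓ ≤ N) (hNup : N ≤ C₁ * (D / E))
    (h4 : 24 * C₁ * ℓ ≤ (κ - 3) * E) (hd3 : (κ - 3) * d ≤ 3 * ℓ)
    (hDl : 121 * ℓ ^ 2 ≤ (κ - 3) * D) : False := by
  set q : ℝ := D / (4 * d) with hq_def
  have hq : 4 * d * q = D := by rw [hq_def]; field_simp
  have hq0 : 0 ≤ q := by positivity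
  have m1 : (q - 5 * ℓ) * E ≤ C₁ * D := by
    have := hNlow.trans hNup
    rwa [← mul_div_assoc, le_div_iff₀ hE] at this
  have m2 : (24 * ℓ * (q - 5 * ℓ)) * E ≤ ((κ - 3) * D) * E :=
    calc (24 * ℓ * (q - 5 * ℓ)) * E = 24 * ℓ * ((q - 5 * ℓ) * E) := by ring
      _ ≤ 24 * ℓ * (C₁ * D) := mul_le_mul_of_nonneg_left m1 (by linarith)
      _ = (24 * C₁ * ℓ) * D := by ring
      _ ≤ ((κ - 3) * E) * D := mul_le_mul_of_nonneg_right h4 hD.le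
      _ = ((κ - 3) * D) * E := by ring
  have m3 : 24 * ℓ * (q - 5 * ℓ) ≤ (κ - 3) * D := le_of_mul_le_mul_right m2 hE
  have m4 : (κ - 3) * D ≤ 12 * ℓ * q := by
    rw [← hq]
    have := mul_le_mul_of_nonneg_left hd3 (by positivity : (0 : ℝ) ≤ 4 * q)
    linarith
  have m5 : 12 * ℓ * q ≤ 120 * ℓ ^ 2 := by linarith
  have hℓ2 : 0 < ℓ ^ 2 := by positivity
  linarith

/-! ## 4. The amplification: violators of `c < rad^{1+ε₀}` have bounded `log c` -/

/-- **Amplification bound.** If the dyadic window primes of every abc triple are counted by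
`C (rad D²)^{1−κ/6+ν(κ−3)/3}` (conclusion of `card_window_primes_le`), then every abc triple with
`log rad(abc) ≤ (1 − 4ν) log c` has `log c ≤ ℓ₀` for some `ℓ₀ = ℓ₀(κ, σ, ν, C)`. -/
theorem exists_log_bound {κ σ ν C : ℝ} (hκ : 3 < κ) (hκ6 : κ < 6) (hσ : 6 < σ) (hν : 0 < ν)
    (hP : ∀ a b c : ℕ, IsABCTriple a b c → ∀ D : ℝ, 1 ≤ D →
      (2 * κ - 6) * Real.log D ≤ 6 * Real.log c - κ * Real.log (rad a b c) →
      6 * Real.log c - σ * Real.log (rad a b c) ≤ (2 * σ - 6) * (Real.log D - Real.log 2) →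
      ((((Nat.primesLE ⌊D⌋₊ \ Nat.primesLE ⌊D / 2⌋₊) \ (a * b * c).primeFactors).card : ℕ) : ℝ) ≤
        C * (((rad a b c : ℕ) : ℝ) * D ^ 2) ^ (1 - κ / 6 + ν * (κ - 3) / 3)) :
    ∃ ℓ₀ : ℝ, ∀ a b c : ℕ, IsABCTriple a b c →
      Real.log (rad a b c) ≤ (1 - 4 * ν) * Real.log c → Real.log c ≤ ℓ₀ := by
  have hκ3 : 0 < κ - 3 := by linarith
  have hκ0 : 0 < κ := by linarith
  set lam : ℝ := (6 - κ * (1 - 4 * ν)) / (2 * κ - 6) with hlam_def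
  have hlam : 0 < lam := by
    apply div_pos _ (by linarith)
    have := mul_pos hκ0 hν
    linarith
  set C₁ : ℝ := max C 1 with hC₁_def
  have hC₁ : 1 ≤ C₁ := le_max_right _ _
  have hCC₁ : C ≤ C₁ := le_max_left _ _
  obtain ⟨D₀, hD₀⟩ := exists_dyadic_primeCounting_lower
  have hT : Tendsto (fun ℓ : ℝ ↦ Real.exp (lam * ℓ)) atTop atTop :=
    Real.tendsto_exp_atTop.comp (tendsto_id.const_mul_atTop hlam)
  have e1 : ∀ᶠ ℓ : ℝ in atTop, (2 * σ - 6) * (κ - 3) * Real.log 2 ≤ 3 * (σ - κ) * ℓ :=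
    (tendsto_id.const_mul_atTop (by linarith : (0 : ℝ) < 3 * (σ - κ))).eventually_ge_atTop _
  have e2 : ∀ᶠ ℓ : ℝ in atTop, D₀ ≤ Real.exp (lam * ℓ) := hT.eventually_ge_atTop D₀
  have e3 : ∀ᶠ ℓ : ℝ in atTop, 2 ≤ Real.exp (lam * ℓ) := hT.eventually_ge_atTop 2
  have e4 : ∀ᶠ ℓ : ℝ in atTop, 24 * C₁ * ℓ ≤ (κ - 3) * Real.exp (2 * ν * ℓ) := by
    have h := (tendsto_exp_mul_div_rpow_atTop 1 (2 * ν) (by linarith)).eventually_ge_atTop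
      (24 * C₁ / (κ - 3))
    filter_upwards [h, eventually_gt_atTop 0] with ℓ hℓ hℓ0
    rw [Real.rpow_one, div_le_div_iff₀ hκ3 hℓ0] at hℓ
    linarith
  have e5 : ∀ᶠ ℓ : ℝ in atTop, 121 * ℓ ^ 2 ≤ (κ - 3) * Real.exp (lam * ℓ) := by
    have h := (tendsto_exp_mul_div_rpow_atTop 2 lam hlam).eventually_ge_atTop (121 / (κ - 3))
    filter_upwards [h, eventually_gt_atTop 0] with ℓ hℓ hℓ0
    rw [Real.rpow_two, div_le_div_iff₀ hκ3 (by positivity)] at hℓ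
    linarith
  have e6 : ∀ᶠ ℓ : ℝ in atTop, 1 ≤ ℓ := eventually_ge_atTop 1
  obtain ⟨ℓ₀, hℓ₀⟩ := Filter.eventually_atTop.1 (e1.and (e2.and (e3.and (e4.and (e5.and e6)))))
  refine ⟨ℓ₀, fun a b c habc hviol ↦ ?_⟩
  by_contra hlt
  push Not at hlt
  obtain ⟨h1, h2, h3, h4, h5, hℓ1⟩ := hℓ₀ (Real.log c) hlt.le
  obtain ⟨ha, hb, hsum, hcop⟩ := habc
  have hc : 0 < c := by omega
  have hn0 : a * b * c ≠ 0 := (Nat.mul_pos (Nat.mul_pos ha hb) hc).ne'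
  have hn2 : 2 ≤ a * b * c :=
    calc 2 ≤ c := by omega
      _ ≤ a * b * c := Nat.le_mul_of_pos_left c (Nat.mul_pos ha hb)
  have hm2 : 2 ≤ rad a b c := Nat.two_le_radical_iff.2 hn2
  have hncube : a * b * c ≤ c ^ 3 := by
    have hac : a ≤ c := by omega
    have hbc : b ≤ c := by omega
    calc a * b * c ≤ c * c * c := by gcongr
      _ = c ^ 3 := by ring
  set ℓ : ℝ := Real.log c with hℓ_def
  set L : ℝ := Real.log (rad a b c) with hL_def
  have hm_pos : (0 : ℝ) < ((rad a b c : ℕ) : ℝ) := by exact_mod_cast (show 0 < rad a b c by omega)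
  have hL2 : Real.log 2 ≤ L := Real.log_le_log two_pos (by exact_mod_cast hm2)
  have hlog2 : (0.6931471803 : ℝ) < Real.log 2 := Real.log_two_gt_d9
  have hL0 : 0 < L := by linarith
  have hLℓ : L ≤ ℓ := by
    have := mul_pos hν (by linarith : (0 : ℝ) < ℓ)
    linarith
  have h26 : (2 * κ - 6) ≠ 0 := ne_of_gt (by linarith)
  set d : ℝ := (6 * ℓ - κ * L) / (2 * κ - 6) with hd_def
  have hd : (2 * κ - 6) * d = 6 * ℓ - κ * L := by
    rw [hd_def]; field_simp
  set D : ℝ := Real.exp d with hD_def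
  have hDpos : 0 < D := Real.exp_pos d
  have hlogD : Real.log D = d := Real.log_exp d
  have hdlam : lam * ℓ ≤ d := by
    rw [hlam_def, div_mul_eq_mul_div, div_le_iff₀ (by linarith : (0 : ℝ) < 2 * κ - 6)]
    have := mul_le_mul_of_nonneg_left hviol hκ0.le
    linarith
  have hDge : Real.exp (lam * ℓ) ≤ D := Real.exp_le_exp.2 hdlam
  have hD2 : 2 ≤ D := h3.trans hDge
  have hD1 : 1 ≤ D := by linarith
  have hDD₀ : D₀ ≤ D := h2.trans hDge
  have hdpos : 0 < d := by rw [← hlogD]; exact Real.log_pos (by linarith)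
  have hd3 : (κ - 3) * d ≤ 3 * ℓ := by
    have := mul_pos hκ0 hL0
    linarith
  have hup : (2 * κ - 6) * Real.log D ≤ 6 * ℓ - κ * L := by rw [hlogD, hd]
  have hlow : 6 * ℓ - σ * L ≤ (2 * σ - 6) * (Real.log D - Real.log 2) := by
    rw [hlogD]
    have key : (κ - 3) * ((2 * σ - 6) * d - (6 * ℓ - σ * L)) = 3 * (σ - κ) * (2 * ℓ - L) := by
      linear_combination (σ - 3) * hd
    have hpos1 : 0 ≤ 3 * (σ - κ) * (ℓ - L) := mul_nonneg (by linarith) (by linarith)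
    have h7 : (κ - 3) * ((2 * σ - 6) * Real.log 2) ≤
        (κ - 3) * ((2 * σ - 6) * d - (6 * ℓ - σ * L)) := by
      rw [key]; linarith
    have := le_of_mul_le_mul_left h7 hκ3
    linarith
  have hN := hP a b c ⟨ha, hb, hsum, hcop⟩ D hD1 hup hlow
  have hπ := hD₀ D hDD₀
  rw [hlogD, ← Nat.primesLE_card_eq_primeCounting, ← Nat.primesLE_card_eq_primeCounting] at hπ
  set A := Nat.primesLE ⌊D⌋₊ with hA_def
  set B := Nat.primesLE ⌊D / 2⌋₊ with hB_def
  set F := (a * b * c).primeFactors with hF_def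
  have hcardNat : A.card ≤ ((A \ B) \ F).card + F.card + B.card := by
    have i1 : A.card ≤ (A \ B).card + B.card := Finset.card_le_card_sdiff_add_card
    have i2 : (A \ B).card ≤ ((A \ B) \ F).card + F.card := Finset.card_le_card_sdiff_add_card
    omega
  have hcardR : (A.card : ℝ) ≤ (((A \ B) \ F).card : ℝ) + F.card + B.card := by
    exact_mod_cast hcardNat
  -- `ω(abc) log 2 ≤ log (abc) ≤ 3 log c`, from `2^{ω(n)} ≤ ∏_{p ∣ n} p ≤ n ≤ c³`
  have hF : (F.card : ℝ) * Real.log 2 ≤ 3 * ℓ := by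
    have i1 : 2 ^ F.card ≤ ∏ p ∈ F, p :=
      Finset.pow_card_le_prod F (fun p ↦ p) 2 (fun p hp ↦ (Nat.prime_of_mem_primeFactors hp).two_le)
    have i2 : ∏ p ∈ F, p ≤ c ^ 3 :=
      (Nat.le_of_dvd (Nat.pos_of_ne_zero hn0) (Nat.prod_primeFactors_dvd _)).trans hncube
    have i3 : (2 : ℝ) ^ F.card ≤ (c : ℝ) ^ 3 := by exact_mod_cast i1.trans i2
    have i4 := Real.log_le_log (by positivity) i3
    rwa [Real.log_pow, Real.log_pow] at i4
  have hF5 : (F.card : ℝ) ≤ 5 * ℓ := by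
    have : (F.card : ℝ) * 0.6 ≤ (F.card : ℝ) * Real.log 2 :=
      mul_le_mul_of_nonneg_left (by linarith) (Nat.cast_nonneg _)
    linarith
  have hNlow : D / (4 * d) - 5 * ℓ ≤ (((A \ B) \ F).card : ℝ) := by linarith
  have hX : 0 < ((rad a b c : ℕ) : ℝ) * D ^ 2 := by positivity
  have hexp : (((rad a b c : ℕ) : ℝ) * D ^ 2) ^ (1 - κ / 6 + ν * (κ - 3) / 3) ≤
      Real.exp (d - 2 * ν * ℓ) := by
    rw [Real.rpow_def_of_pos hX, Real.log_mul hm_pos.ne' (by positivity), Real.log_pow, hlogD]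
    push_cast
    exact Real.exp_le_exp.2 (exponent_mul_log_le hκ hν hL0.le hviol hd)
  have hNup : (((A \ B) \ F).card : ℝ) ≤ C₁ * Real.exp (d - 2 * ν * ℓ) :=
    calc _ ≤ C * (((rad a b c : ℕ) : ℝ) * D ^ 2) ^ (1 - κ / 6 + ν * (κ - 3) / 3) := hN
      _ ≤ C₁ * (((rad a b c : ℕ) : ℝ) * D ^ 2) ^ (1 - κ / 6 + ν * (κ - 3) / 3) :=
          mul_le_mul_of_nonneg_right hCC₁ (Real.rpow_nonneg hX.le _)
      _ ≤ C₁ * Real.exp (d - 2 * ν * ℓ) := mul_le_mul_of_nonneg_left hexp (by linarith)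
  have hexpDE : Real.exp (d - 2 * ν * ℓ) = D / Real.exp (2 * ν * ℓ) := by
    rw [hD_def, Real.exp_sub]
  rw [hexpDE] at hNup
  have hD_lower : 121 * ℓ ^ 2 ≤ (κ - 3) * D := h5.trans (mul_le_mul_of_nonneg_left hDge hκ3.le)
  exact endgame_false hℓ1 hdpos hDpos (Real.exp_pos _) hNlow hNup h4 hd3 hD_lower

end Summit.ABC.ABC.Theorems.FreyAmplification

open Summit.ABC.ABC.Theorems.FreyAmplification in
/-- **`FreyAmplification` (item stmt-ABC-2778 of route `TwistAmplification`).** If for some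
`3 < κ < 6 < σ` the Frey–twist window count `|S| ≤ C X^{1−κ/6+ε}` holds for every `ε > 0`, then the
abc conjecture `ABC` holds: a violator `c ≥ rad(abc)^{1+ε₀}` with `c` large would, twisted by the
`≫ D / log D` primes `p ∈ (D/2, D]`, `log D = (6 log c − κ log rad)/(2κ−6)`, produce more window data at
scale `X = rad · D²` than `C X^{1−κ/6+ε}` allows (`ε = ε₀(κ−3)/(12(1+ε₀))`). -/
theorem Summit.ABC.ABC.Theorems.FreyAmplification_proof :
    Summit.ABC.ABC.Theses.TwistAmplification.FreyAmplification := by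
  unfold Summit.ABC.ABC.Theses.TwistAmplification.FreyAmplification
  rintro ⟨κ, σ, hκ, hκ6, hσ, hwin⟩
  refine _root_.ABC_iff.mpr ?_
  intro ε₀ hε₀
  have hκ3 : 0 < κ - 3 := by linarith
  set ν : ℝ := ε₀ / (4 * (1 + ε₀)) with hν_def
  have hν : 0 < ν := by positivity
  obtain ⟨C, hC⟩ := hwin (ν * (κ - 3) / 3) (by positivity)
  obtain ⟨ℓ₀, hℓ₀⟩ := exists_log_bound hκ hκ6 hσ hν
    (fun a b c habc D hD hup hlow ↦ card_window_primes_le hκ hσ hC habc hD hup hlow)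
  refine ⟨Real.exp ℓ₀ + 1, by positivity, fun a b c habc ↦ ?_⟩
  have hm1 : (1 : ℝ) ≤ ((rad a b c : ℕ) : ℝ) := by exact_mod_cast Nat.radical_pos _
  have hpow1 : (1 : ℝ) ≤ ((rad a b c : ℕ) : ℝ) ^ (1 + ε₀) := Real.one_le_rpow hm1 (by linarith)
  by_cases hv : ((rad a b c : ℕ) : ℝ) ^ (1 + ε₀) ≤ (c : ℝ)
  · have hc0 : (0 : ℝ) < c := lt_of_lt_of_le (by positivity) hv
    have hlog : (1 + ε₀) * Real.log (rad a b c) ≤ Real.log c := by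
      have := Real.log_le_log (by positivity) hv
      rwa [Real.log_rpow (by positivity)] at this
    have hviol : Real.log (rad a b c) ≤ (1 - 4 * ν) * Real.log c := by
      have h14 : (1 - 4 * ν) * Real.log c = Real.log c / (1 + ε₀) := by
        rw [hν_def]; field_simp; ring
      rw [h14, le_div_iff₀ (by positivity)]
      linarith
    have hcle := hℓ₀ a b c habc hviol
    rw [Real.log_le_iff_le_exp hc0] at hcle
    calc (c : ℝ) < Real.exp ℓ₀ + 1 := by linarith
      _ ≤ (Real.exp ℓ₀ + 1) * ((rad a b c : ℕ) : ℝ) ^ (1 + ε₀) :=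
          le_mul_of_one_le_right (by positivity) hpow1
  · push Not at hv
    calc (c : ℝ) < ((rad a b c : ℕ) : ℝ) ^ (1 + ε₀) := hv
      _ = 1 * ((rad a b c : ℕ) : ℝ) ^ (1 + ε₀) := (one_mul _).symm
      _ ≤ (Real.exp ℓ₀ + 1) * ((rad a b c : ℕ) : ℝ) ^ (1 + ε₀) :=
          mul_le_mul_of_nonneg_right (by linarith [Real.exp_pos ℓ₀]) (by positivity)
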